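import Mathlib
import HarnessLib

/-!
# Rung S-2 `PersistenceSurface` (stmt-ResolutionOfSingularities-19970) — POINTED CYCLES V: the DICHOTOMY for almost-nef
# cycles at a reduced curve of the fundamental cycle (memo K-PCC §9 Thm 3.1; res-L1-w44b-lead-1 g4)

Route `ResolutionOfSingularities/HomologicalConductor`, chain W4.4b, rung S-2 `PersistenceSurface` (stmt-19970), stub C3′ /
local core.  `[OURS · L1 w44b]`; replaces the role of no printed item; NOT a statement of the manuscript under review
(Hironaka 2017); AI-written elementary lattice arithmetic, weaker than expert review.  Def-free; independent sequel of
`…PersistencePointedCycles` (p564614) / `…Definite` (p565092) / `…Parity` / `…Path`.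

## Content
`M : ι → ι → ℤ` SYMMETRIC with non-negative off-diagonal entries (the intersection matrix), `z : ι → ℕ` an effective
ANTI-NEF cycle (`z·C_i ≤ 0`, e.g. the fundamental cycle `Z_f`) with `z ≥ 1` everywhere and `z_t = 1`, and `A : ι → ℕ`
ALMOST NEF at `t` (`A·C_i ≥ −δ_it`).  Computing `A·z` in the two ways
`Σ_j a_j (z·C_j) = A·z = Σ_i z_i (A·C_i)` gives `−1 = −z_t ≤ A·z ≤ 0`, whence the

**DICHOTOMY (`tight_or_offNull_eq_zero`):** EITHER every constraint is tight — `A·C_i = −δ_it` for all `i`, i.e.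
`M·A = −e_t`, so `A` IS the dual cycle `D_t` and `D_t` is integral (`[δ_t] = 0` in the discriminant group) — OR `A`
vanishes at every curve `C_j` with `z·C_j < 0` (the `z`-NON-NULL curves).  In the second case `A` lives on the
`z`-null sub-configuration, where (memo K-PCC §9) it splits along connected components and vanishes off the component
of `t`; so **NP(t) holds whenever `(Z_f)_t = 1`, `D_t ∉ ℤ^ι`, and `𝒜_t` of the null component of `t` is `{0}`**
(e.g. an `A`-path, p564614/K-PCC Rem 2.5) — the two-lookup NP test used for the cusp census (§3(b)) and for the
chain-arrival persistence theorem (Thm 4.3) on reduced-`Z_f` stages.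

* `sum_sum_comm_of_symm` — `Σ_i z_i (A·C_i) = Σ_j a_j (z·C_j)` for symmetric `M`;
* `neg_one_le_pairing_sum`, `pairing_sum_nonpos` — the two bounds;
* **`tight_or_offNull_eq_zero`** — the dichotomy; `apply_eq_zero_of_not_tight` — the NP-test form.

References (mechanism only): M. Artin, Amer. J. Math. 88 (1966) (fundamental cycle); this work (memo K-PCC §9).
-/

-- single-problem summit: the doubled namespace component `ResolutionOfSingularities` is forced
set_option linter.dupNamespace false

namespace Summit.ResolutionOfSingularities.ResolutionOfSingularities.Theorems.HomologicalConductor.PersistencePointedCyclesFundamental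

open Finset

variable {ι : Type*} [Fintype ι] [DecidableEq ι]

omit [DecidableEq ι] in
/-- **Two ways to compute `A·z`** for a symmetric matrix: `Σ_i z_i (Σ_j a_j M j i) = Σ_j a_j (Σ_i z_i M i j)`.
[folklore] -/
theorem sum_sum_comm_of_symm (M : ι → ι → ℤ) (hsymm : ∀ i j, M i j = M j i) (z A : ι → ℕ) :
    ∑ i, (z i : ℤ) * ∑ j, (A j : ℤ) * M j i = ∑ j, (A j : ℤ) * ∑ i, (z i : ℤ) * M i j := by
  simp only [mul_sum]
  rw [sum_comm]
  refine sum_congr rfl fun j _ => sum_congr rfl fun i _ => ?_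
  rw [hsymm j i]; ring

/-- **Lower bound:** if `A·C_i ≥ −δ_it` for all `i` and `z ≥ 0` with `z_t = 1`, then `Σ_i z_i (A·C_i) ≥ −1`.
[this work] -/
theorem neg_one_le_pairing_sum (M : ι → ι → ℤ) (t : ι) (z A : ι → ℕ) (hzt : z t = 1)
    (hA : ∀ i, -(if i = t then (1 : ℤ) else 0) ≤ ∑ j, (A j : ℤ) * M j i) :
    -1 ≤ ∑ i, (z i : ℤ) * ∑ j, (A j : ℤ) * M j i := by
  have hterm : ∀ i, -(if i = t then (1 : ℤ) else 0) ≤ (z i : ℤ) * ∑ j, (A j : ℤ) * M j i := by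
    intro i
    by_cases hit : i = t
    · subst hit; rw [hzt]; simpa using hA i
    · have h := hA i
      simp only [hit, if_false, neg_zero] at h ⊢
      exact mul_nonneg (Nat.cast_nonneg _) h
  calc (-1 : ℤ) = ∑ i, -(if i = t then (1 : ℤ) else 0) := by simp
    _ ≤ ∑ i, (z i : ℤ) * ∑ j, (A j : ℤ) * M j i := sum_le_sum fun i _ => hterm i

omit [DecidableEq ι] in
/-- **Upper bound:** if `z·C_j ≤ 0` for all `j` and `A ≥ 0` then `Σ_j a_j (z·C_j) ≤ 0`. [this work] -/
theorem pairing_sum_nonpos (M : ι → ι → ℤ) (z A : ι → ℕ) (hz : ∀ j, ∑ i, (z i : ℤ) * M i j ≤ 0) :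
    ∑ j, (A j : ℤ) * ∑ i, (z i : ℤ) * M i j ≤ 0 :=
  sum_nonpos fun j _ => mul_nonpos_of_nonneg_of_nonpos (Nat.cast_nonneg _) (hz j)

/-- **THE DICHOTOMY** (memo K-PCC §9 Thm 3.1).  `M` symmetric, `z` effective anti-nef with `z_i ≥ 1` for all `i` and
`z_t = 1` (a reduced curve of the fundamental cycle), `A` almost nef at `t`.  Then EITHER all constraints are tight
(`A·C_i = −δ_it ∀ i`: `A` is the integral dual cycle `D_t`) OR `A` vanishes at every `z`-non-null curve
(`z·C_j < 0 ⇒ a_j = 0`).  Proof: `−1 ≤ A·z ≤ 0`; if `A·z = −1` the lower-bound terms are all at their minimum; if `A·z = 0`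
the upper-bound terms all vanish. [this work] -/
theorem tight_or_offNull_eq_zero (M : ι → ι → ℤ) (hsymm : ∀ i j, M i j = M j i) (t : ι) (z A : ι → ℕ)
    (hzt : z t = 1) (hz1 : ∀ i, 1 ≤ z i) (hz : ∀ j, ∑ i, (z i : ℤ) * M i j ≤ 0)
    (hA : ∀ i, -(if i = t then (1 : ℤ) else 0) ≤ ∑ j, (A j : ℤ) * M j i) :
    (∀ i, ∑ j, (A j : ℤ) * M j i = -(if i = t then 1 else 0)) ∨
      (∀ j, ∑ i, (z i : ℤ) * M i j < 0 → A j = 0) := by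
  have hlo := neg_one_le_pairing_sum M t z A hzt hA
  have hhi := pairing_sum_nonpos M z A hz
  have hcomm := sum_sum_comm_of_symm M hsymm z A
  -- the common value S := A·z ∈ {−1, 0}
  set S := ∑ i, (z i : ℤ) * ∑ j, (A j : ℤ) * M j i with hS
  have hS' : S = ∑ j, (A j : ℤ) * ∑ i, (z i : ℤ) * M i j := hcomm
  have hS01 : S = -1 ∨ S = 0 := by rw [hS'] at *; omega
  rcases hS01 with h1 | h0
  · -- tight case: Σ_i (z_i (A·C_i) + δ_it) = 0 with non-negative summands
    left
    have hnn : ∀ i ∈ (univ : Finset ι), 0 ≤ (z i : ℤ) * ∑ j, (A j : ℤ) * M j i + (if i = t then 1 else 0) := by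
      intro i _
      by_cases hit : i = t
      · subst hit; rw [hzt]; have := hA i; simp only [if_true] at this ⊢; push_cast; linarith
      · have := hA i; simp only [hit, if_false, neg_zero] at this ⊢
        simpa using mul_nonneg (Nat.cast_nonneg (z i)) this
    have hsum0 : ∑ i, ((z i : ℤ) * ∑ j, (A j : ℤ) * M j i + (if i = t then 1 else 0)) = 0 := by
      rw [sum_add_distrib, ← hS, h1]; simp
    have hall := (sum_eq_zero_iff_of_nonneg hnn).1 hsum0
    intro i
    have hi := hall i (mem_univ i)
    by_cases hit : i = t
    · subst hit; rw [hzt] at hi; simp only [if_true] at hi ⊢; push_cast at hi; linarith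
    · simp only [hit, if_false] at hi ⊢
      have hzpos : (0 : ℤ) < z i := by exact_mod_cast hz1 i
      have := hA i; simp only [hit, if_false, neg_zero] at this
      rw [add_zero] at hi
      rcases mul_eq_zero.1 hi with h | h
      · exact absurd h (ne_of_gt hzpos)
      · simpa using h
  · -- null case: Σ_j a_j (z·C_j) = 0 with non-positive summands
    right
    have hnp : ∀ j ∈ (univ : Finset ι), (A j : ℤ) * ∑ i, (z i : ℤ) * M i j ≤ 0 :=
      fun j _ => mul_nonpos_of_nonneg_of_nonpos (Nat.cast_nonneg _) (hz j)
    have hsum0 : ∑ j, (A j : ℤ) * ∑ i, (z i : ℤ) * M i j = 0 := by rw [← hS', h0]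
    have hall := (sum_eq_zero_iff_of_nonpos hnp).1 hsum0
    intro j hj
    have h := hall j (mem_univ j)
    rcases mul_eq_zero.1 h with h' | h'
    · exact_mod_cast h'
    · exact absurd h' (ne_of_lt hj)

/-- **NP test, lattice form.** Under the hypotheses of the dichotomy, if the constraints are NOT all tight (e.g. `D_t` is
not integral: no effective `A` with `M·A = −e_t` exists) then `A` vanishes at every `z`-non-null curve; if moreover
every almost-nef-at-`t` cycle supported on the `z`-null curves vanishes (e.g. the null component of `t` is an `A`-path,
or `t` itself is non-null), NP(t) follows. [this work] -/
theorem apply_eq_zero_of_not_tight (M : ι → ι → ℤ) (hsymm : ∀ i j, M i j = M j i) (t : ι) (z A : ι → ℕ)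
    (hzt : z t = 1) (hz1 : ∀ i, 1 ≤ z i) (hz : ∀ j, ∑ i, (z i : ℤ) * M i j ≤ 0)
    (hA : ∀ i, -(if i = t then (1 : ℤ) else 0) ≤ ∑ j, (A j : ℤ) * M j i)
    (hnt : ¬ ∀ i, ∑ j, (A j : ℤ) * M j i = -(if i = t then 1 else 0)) :
    ∀ j, ∑ i, (z i : ℤ) * M i j < 0 → A j = 0 :=
  (tight_or_offNull_eq_zero M hsymm t z A hzt hz1 hz hA).resolve_left hnt

/-- **`t` non-null ⇒ tight.** If in addition `z·C_t < 0` and `A ≠ 0` then the constraints are all tight (the null case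
would force `a_t = 0`, but a non-zero almost-nef cycle has `a_t ≥ 1` — here we take that corner fact as a hypothesis,
p565092 `one_le_apply_of_isPointedAlmostNef`). [this work] -/
theorem tight_of_nonNull (M : ι → ι → ℤ) (hsymm : ∀ i j, M i j = M j i) (t : ι) (z A : ι → ℕ)
    (hzt : z t = 1) (hz1 : ∀ i, 1 ≤ z i) (hz : ∀ j, ∑ i, (z i : ℤ) * M i j ≤ 0)
    (hA : ∀ i, -(if i = t then (1 : ℤ) else 0) ≤ ∑ j, (A j : ℤ) * M j i)
    (ht : ∑ i, (z i : ℤ) * M i t < 0) (hcorner : 1 ≤ A t) :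
    ∀ i, ∑ j, (A j : ℤ) * M j i = -(if i = t then 1 else 0) := by
  rcases tight_or_offNull_eq_zero M hsymm t z A hzt hz1 hz hA with h | h
  · exact h
  · have := h t ht; omega

/-! ## The case `z_t = 2` (memo K-PCC §10 Thm 3.1′): rank-two centres of stars -/

/-- **Lower bound, weight two:** if `A·C_i ≥ −δ_it` and `z_t = 2` then `Σ_i z_i (A·C_i) ≥ −2`. [this work] -/
theorem neg_two_le_pairing_sum (M : ι → ι → ℤ) (t : ι) (z A : ι → ℕ) (hzt : z t = 2)
    (hA : ∀ i, -(if i = t then (1 : ℤ) else 0) ≤ ∑ j, (A j : ℤ) * M j i) :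
    -2 ≤ ∑ i, (z i : ℤ) * ∑ j, (A j : ℤ) * M j i := by
  have hterm : ∀ i, -(if i = t then (2 : ℤ) else 0) ≤ (z i : ℤ) * ∑ j, (A j : ℤ) * M j i := by
    intro i
    by_cases hit : i = t
    · subst hit; rw [hzt]; have := hA i; simp only [if_true] at this ⊢; push_cast; linarith
    · have h := hA i
      simp only [hit, if_false, neg_zero] at h ⊢
      exact mul_nonneg (Nat.cast_nonneg _) h
  calc (-2 : ℤ) = ∑ i, -(if i = t then (2 : ℤ) else 0) := by simp
    _ ≤ ∑ i, (z i : ℤ) * ∑ j, (A j : ℤ) * M j i := sum_le_sum fun i _ => hterm i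

/-- **THE TRICHOTOMY at a curve of multiplicity two** (memo K-PCC §10 Thm 3.1′).  `M` symmetric, `z` effective anti-nef
with `z ≥ 1` and `z_t = 2`, `A` almost nef at `t`.  Then `A·z ∈ {−2, −1, 0}` and accordingly EITHER all constraints are
tight (`A·C_i = −δ_it`: `A = D_t` integral), OR `A·C_t = −1` and there is exactly one further curve `i₀` with
`A·C_{i₀} ≠ 0`, namely `z_{i₀} = 1` and `A·C_{i₀} = 1` (`A = D_t − D_{i₀}` integral and effective), OR `A` vanishes at
every `z`-non-null curve.  This is the NP test at the rank-two centre of a star-shaped rational arrival. [this work] -/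
theorem tight_or_oneDefect_or_offNull (M : ι → ι → ℤ) (hsymm : ∀ i j, M i j = M j i) (t : ι) (z A : ι → ℕ)
    (hzt : z t = 2) (hz1 : ∀ i, 1 ≤ z i) (hz : ∀ j, ∑ i, (z i : ℤ) * M i j ≤ 0)
    (hA : ∀ i, -(if i = t then (1 : ℤ) else 0) ≤ ∑ j, (A j : ℤ) * M j i) :
    (∀ i, ∑ j, (A j : ℤ) * M j i = -(if i = t then 1 else 0)) ∨
      ((∑ j, (A j : ℤ) * M j t = -1) ∧ ∃ i₀, i₀ ≠ t ∧ z i₀ = 1 ∧ (∑ j, (A j : ℤ) * M j i₀ = 1) ∧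
        ∀ i, i ≠ t → i ≠ i₀ → ∑ j, (A j : ℤ) * M j i = 0) ∨
      (∀ j, ∑ i, (z i : ℤ) * M i j < 0 → A j = 0) := by
  have hlo := neg_two_le_pairing_sum M t z A hzt hA
  have hhi := pairing_sum_nonpos M z A hz
  have hcomm := sum_sum_comm_of_symm M hsymm z A
  set S := ∑ i, (z i : ℤ) * ∑ j, (A j : ℤ) * M j i with hS
  have hS' : S = ∑ j, (A j : ℤ) * ∑ i, (z i : ℤ) * M i j := hcomm
  -- abbreviate the pairings
  set p : ι → ℤ := fun i => ∑ j, (A j : ℤ) * M j i with hp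
  have hpt : -1 ≤ p t := by have := hA t; simpa [hp] using this
  have hpi : ∀ i, i ≠ t → 0 ≤ p i := fun i hit => by have := hA i; simpa [hp, hit] using this
  -- the shifted non-negative terms w_i := z_i p_i + 2δ_it sum to S + 2
  have hw_nonneg : ∀ i ∈ (univ : Finset ι), 0 ≤ (z i : ℤ) * p i + (if i = t then 2 else 0) := by
    intro i _
    by_cases hit : i = t
    · subst hit; rw [hzt]; simp only [if_true]; push_cast; linarith
    · simp only [hit, if_false, add_zero]; exact mul_nonneg (Nat.cast_nonneg _) (hpi i hit)
  have hw_sum : ∑ i, ((z i : ℤ) * p i + (if i = t then 2 else 0)) = S + 2 := by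
    rw [sum_add_distrib, ← hS]; simp
  have hS012 : S = -2 ∨ S = -1 ∨ S = 0 := by rw [hS'] at *; omega
  rcases hS012 with h2 | h1 | h0
  · -- all shifted terms vanish: tight
    left
    have hall := (sum_eq_zero_iff_of_nonneg hw_nonneg).1 (by rw [hw_sum, h2]; norm_num)
    intro i
    have hi := hall i (mem_univ i)
    show p i = _
    by_cases hit : i = t
    · subst hit; rw [hzt] at hi; simp only [if_true] at hi ⊢; push_cast at hi; linarith
    · simp only [hit, if_false, add_zero] at hi ⊢
      have hzpos : (0 : ℤ) < z i := by exact_mod_cast hz1 i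
      rcases mul_eq_zero.1 hi with h | h
      · exact absurd h (ne_of_gt hzpos)
      · exact h
  · -- the shifted terms sum to 1: exactly one of them is 1
    right; left
    have hsum1 : ∑ i, ((z i : ℤ) * p i + (if i = t then 2 else 0)) = 1 := by rw [hw_sum, h1]; norm_num
    -- the t-term is even (= 2(p t + 1)), hence it is 0 and p t = -1
    have hle_t : (z t : ℤ) * p t + 2 ≤ 1 := by
      have := single_le_sum hw_nonneg (mem_univ t)
      simp only [if_true] at this; linarith
    have hpt' : p t = -1 := by rw [hzt] at hle_t; push_cast at hle_t; omega
    refine ⟨hpt', ?_⟩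
    -- some other term is non-zero
    have hrest : ∑ i ∈ univ.erase t, ((z i : ℤ) * p i + (if i = t then 2 else 0)) = 1 := by
      have := add_sum_erase univ (fun i => (z i : ℤ) * p i + (if i = t then 2 else 0)) (mem_univ t)
      simp only [if_true] at this
      rw [hzt, hpt'] at this; push_cast at this; linarith
    obtain ⟨i₀, hi₀mem, hi₀ne⟩ := exists_ne_zero_of_sum_ne_zero (by rw [hrest]; norm_num)
    have hi₀t : i₀ ≠ t := (mem_erase.1 hi₀mem).1
    have hnn' : ∀ i ∈ univ.erase t, 0 ≤ (z i : ℤ) * p i + (if i = t then 2 else 0) :=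
      fun i hi => hw_nonneg i (mem_univ i)
    have hle₀ : (z i₀ : ℤ) * p i₀ ≤ 1 := by
      have := single_le_sum hnn' hi₀mem
      simp only [hi₀t, if_false, add_zero] at this; linarith
    have hge₀ : 0 ≤ (z i₀ : ℤ) * p i₀ := mul_nonneg (Nat.cast_nonneg _) (hpi i₀ hi₀t)
    simp only [hi₀t, if_false, add_zero] at hi₀ne
    have heq₀ : (z i₀ : ℤ) * p i₀ = 1 := by omega
    have hz₀ : (1 : ℤ) ≤ z i₀ := by exact_mod_cast hz1 i₀
    have hp₀ : 0 ≤ p i₀ := hpi i₀ hi₀t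
    have hz₀1 : z i₀ = 1 := by
      have : (z i₀ : ℤ) = 1 := Int.eq_one_of_mul_eq_one_right (Nat.cast_nonneg _) heq₀
      exact_mod_cast this
    have hp₀1 : p i₀ = 1 := by rw [hz₀1] at heq₀; simpa using heq₀
    refine ⟨i₀, hi₀t, hz₀1, hp₀1, fun i hit hii₀ => ?_⟩
    -- every other term vanishes: the pair {i₀, i} already exhausts the sum 1
    have hpair : ((z i₀ : ℤ) * p i₀ + 0) + ((z i : ℤ) * p i + 0) ≤ 1 := by
      have hsub : ({i₀, i} : Finset ι) ⊆ univ.erase t := by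
        intro j hj; rw [mem_insert, mem_singleton] at hj; rw [mem_erase]
        rcases hj with rfl | rfl
        · exact ⟨hi₀t, mem_univ _⟩
        · exact ⟨hit, mem_univ _⟩
      have := sum_le_sum_of_subset_of_nonneg hsub (fun j hj _ => hnn' j hj)
      rw [sum_insert (by simpa using fun h => hii₀ h.symm), sum_singleton, hrest] at this
      simpa [hi₀t, hit] using this
    have hge : 0 ≤ (z i : ℤ) * p i := mul_nonneg (Nat.cast_nonneg _) (hpi i hit)
    have hzero : (z i : ℤ) * p i = 0 := by rw [heq₀] at hpair; linarith
    have hzpos : (0 : ℤ) < z i := by exact_mod_cast hz1 i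
    rcases mul_eq_zero.1 hzero with h | h
    · exact absurd h (ne_of_gt hzpos)
    · exact h
  · -- null case
    right; right
    have hnp : ∀ j ∈ (univ : Finset ι), (A j : ℤ) * ∑ i, (z i : ℤ) * M i j ≤ 0 :=
      fun j _ => mul_nonpos_of_nonneg_of_nonpos (Nat.cast_nonneg _) (hz j)
    have hsum0 : ∑ j, (A j : ℤ) * ∑ i, (z i : ℤ) * M i j = 0 := by rw [← hS', h0]
    have hall := (sum_eq_zero_iff_of_nonpos hnp).1 hsum0
    intro j hj
    have h := hall j (mem_univ j)
    rcases mul_eq_zero.1 h with h' | h'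
    · exact_mod_cast h'
    · exact absurd h' (ne_of_lt hj)

/-! ## No integral dual cycle on the reduced-`Z_f` class (memo K-PCC §11 Prop 11.1) -/

omit [DecidableEq ι] in
/-- **`[δ_t] ≠ 0` on Kollár-minimal graphs** (memo K-PCC §11 Prop 11.1, lattice core).  Let `M` be symmetric, let the
reduced cycle `E = (1,…,1)` be anti-nef (`Σ_i M i j ≤ 0` for all `j`: `b_j ≥ val_j`) with `E·E = Σ_j Σ_i M i j ≤ −2`
(the singularity has multiplicity `≥ 2`).  Then NO integral cycle `D ≥ E` satisfies `D·C_i = −δ_it`: the class `[δ_t]`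
is non-zero in the discriminant group, so case (i) of the dichotomy `tight_or_offNull_eq_zero` never occurs on this
class (given that a tight `A` is automatically `≥ Z_f = E`, by `…Definite.nonneg_of_isPointedAntinef` + fundamental-cycle
minimality).  Proof: `−1 = Σ_i D·C_i = Σ_j D_j (E·C_j) ≤ Σ_j (E·C_j) = E·E ≤ −2`. [this work] -/
theorem not_tight_of_reduced_antinef (M : ι → ι → ℤ) (hsymm : ∀ i j, M i j = M j i) (t : ι) [DecidableEq ι]
    (hE : ∀ j, ∑ i, M i j ≤ 0) (hE2 : ∑ j, ∑ i, M i j ≤ -2) (D : ι → ℕ) (hD1 : ∀ j, 1 ≤ D j)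
    (hD : ∀ i, ∑ j, (D j : ℤ) * M j i = -(if i = t then 1 else 0)) : False := by
  -- Σ_i D·C_i = −1
  have h1 : ∑ i, ∑ j, (D j : ℤ) * M j i = -1 := by
    rw [sum_congr rfl fun i _ => hD i]; simp
  -- Σ_i D·C_i = Σ_j D_j (E·C_j) ≤ Σ_j E·C_j = E·E
  have h2 : ∑ i, ∑ j, (D j : ℤ) * M j i = ∑ j, (D j : ℤ) * ∑ i, M j i := by
    rw [sum_comm]; exact sum_congr rfl fun j _ => by rw [mul_sum]
  have h3 : ∀ j, (D j : ℤ) * ∑ i, M j i ≤ ∑ i, M j i := by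
    intro j
    have hEj : ∑ i, M j i ≤ 0 := by
      have := hE j; rwa [show ∑ i, M i j = ∑ i, M j i from sum_congr rfl fun i _ => hsymm i j] at this
    have hDj : (1 : ℤ) ≤ D j := by exact_mod_cast hD1 j
    nlinarith
  have h4 : ∑ j, (D j : ℤ) * ∑ i, M j i ≤ ∑ j, ∑ i, M j i := sum_le_sum fun j _ => h3 j
  have h5 : ∑ j, ∑ i, M j i = ∑ j, ∑ i, M i j := sum_congr rfl fun j _ => sum_congr rfl fun i _ => hsymm j i
  linarith [h1, h2, h4, h5, hE2]

end Summit.ResolutionOfSingularities.ResolutionOfSingularities.Theorems.HomologicalConductor.PersistencePointedCyclesFundamental
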